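import Mathlib
import Literature.MathematicalPhysics.QuantumFieldTheory.Balaban1983to89.Beta.GaussianIntegral

/-! # `Balaban1983to89.B9Eq3168Jac` — B9 Sect. E p. 430, (3.168)–(3.169): *"The integral (3.168) is equal to G(μ(B))"*
# — the Jacobian of the averaging ⊕ axial-gauge constraint map is EXACTLY 1, kernel-checked

CITATION HEADER.  Unit `b2b-balaban-b09` (gen 14, cell pub-balaban), PAPER SUB-CELL B09 =
T. Balaban, *Propagators for lattice gauge theories in a background field*, Commun. Math. Phys. **99** (1985) 389–434
[`Balaban1985BackgroundPropagators`] (= B9).  Sect. E, p. 430 [PDF 42] (render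
`1985-cmp99-background-propagators-p042-x2.png`, READ AS AN IMAGE — the Euclid text layer is unreliable), verbatim:
*"In this integral we change the order of B- and μ-integrations, and we perform the gauge transformation B → B + D̄μ.
This gives us the following μ-integral to calculate
∫dμ δ(Q′₁μ)δ_{Ax}(B + D̄μ)G(μ). (3.168)
The δ-functions above determine μ uniquely as a linear function of B. Indeed, denoting V = Ū^k, we have for x∈B(y),
y∈Λ′
(R_y(V)(B + D̄μ))(Γ_{y,x}) = (R_y(V)B)(Γ_{y,x}) + R(V(Γ_{y,x}))μ(x) − μ(y) = 0,
hence R(V(Γ_{y,x}))μ(x) = μ(y) − (R_y(V)B)(Γ_{y,x}), and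
(Q′μ)(y) = Σ_{x∈B(y)} L^{−d}R(V(Γ_{y,x}))μ(x) = μ(y) − Σ_{x∈B(y)} L^{−d}(R_y(V)B)(Γ_{y,x}) = μ(y) − Q′(R_y(V)B)(Γ_{y,·}) = 0.
This implies μ(y) = Q′(R_y(V)B)(Γ_{y,·}), μ(x) = R(V(Γ_{x,y}))Q′(R_y(V)B)(Γ_{y,·}) − R(V(Γ_{x,y}))(R_y(V)B)(Γ_{y,x}),
x∈B(y), x ≠ y. (3.169)
We denote the linear function defined by the above formulas by μ(B). The integral (3.168) is equal to G(μ(B))."*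
With p. 390 [PDF 2] (*"R(U)X = UXU⁻¹"*, an ORTHOGONAL map of the Lie algebra for the `tr X\*X` inner product) and
p. 393 [PDF 5] (3.18)–(3.19) (the block averaging `Q′(V)` with weights `L^{−d}` over the `L^d` points of a block).

THE POINT.  The printed sentence *"The integral (3.168) is equal to G(μ(B))"* says MORE than (3.169): composing
δ-functions with the linear constraint map `𝒥 : μ ↦ ((Q′μ)(y))_{y∈Λ′} ⊕ ((R_y(V)D̄μ)(Γ_{y,x}))_{x∈B(y), x≠y}` produces
`|det 𝒥|⁻¹ · G(𝒥⁻¹(data))` (`integral_delta_linear` below), so "= G(μ(B))" with NO constant asserts `|det 𝒥| = 1`.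
(3.169) — existence, uniqueness, linearity and locality of `μ(B)` — is KERNEL in this lineage's `B9Eq3169Mu`
(`AxialFrame.mu`, `mu_unique`, `axial_mu`, `avg_mu`; GAPS C-B9-57), which gives invertibility of `𝒥` only; the cell's
hand certifications (C-adv4-55, C-adv8-2, slips G-adv8-2) record the constant as "absorbed in Z".  This file
certifies that the constant is exactly `1` (C-B9-57 residual (i), second half; the first half — (3.160)/(3.166) — is
this lineage's `B9Eq3166`).

DICTIONARY / READING.  Finite site set `S` (the points of `Λ` carrying `μ`), a BLOCK STRUCTURE given by an idempotent
base-point map `blk : S → S` (`blk x = y` ⟺ `x ∈ B(y)`; `y` is a base point ⟺ `blk y = y`; this is the base-site map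
of `B9Eq3169Mu.AxialFrame`), WEIGHTS `w : S → ℝ` with `Σ_{x∈B(y)} w x = 1` for every base point `y` (print:
`w ≡ L^{−d}` on blocks of `L^d` points, (3.18); no sign condition is needed), the Lie algebra `𝔤 ≅ (d → ℝ)` with the
`tr X\*X` inner product, and for every site the TRANSPORT `O x := R(V(Γ_{blk x, x})) : 𝔤 → 𝔤`, an orthogonal matrix
(`(O x)ᵀ(O x) = 1`; `O y = 1` for a base point, `Γ_{y,y}` being the empty contour — not needed below).  By the first
display of (3.169) (kernel: `B9Eq3169Mu.trSum_cod`), in the TRANSPORTED VARIABLES `ν(x) := (O x)μ(x)` the constraints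
read `(Q′μ)(y) = Σ_{x∈B(y)} w x · ν(x)` (row `y`, base) and `(R_y(V)D̄μ)(Γ_{y,x}) = ν(x) − ν(y)` (row `x`, non-base,
`y = blk x`, using `ν(y) = μ(y)`).  Hence `𝒥 = (1_𝔤 ⊗ jac blk w) ∘ T`, where
* `jac blk w : Matrix S S ℝ` — row `i` base: `j ↦ [blk j = i]·w j`; row `i` non-base: `e_i − e_{blk i}` (`jac`);
* `T = blockDiagonal O` on `𝔤^S = (d × S → ℝ)` and `1_𝔤 ⊗ jac` = `(1 : Matrix d d ℝ) ⊗ₖ jac blk w` (Mathlib's Kronecker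
  product, indices `d × S`); `fullJac_apply`: `(𝒥μ)(a, x) = Σ_{x′} (jac blk w) x x′ · ((O x′)μ(x′))_a`.
The δ-functions: `∫dμ δ(𝒥μ − c)G(μ)` for data `c` (`c = 0` on base rows — `δ(Q′₁μ)` — and `c = −(R_y(V)B)(Γ_{y,x})` on
the axial rows — `δ_{Ax}(B + D̄μ)`) is READ, as always, through its integral against test functions `ψ(c)`:
`∫dμ G(μ)ψ(𝒥μ)`; the identity of continuous densities then holds at every `c`, in particular at the printed one.

WHAT THIS FILE CERTIFIES (kernel, zero sorry; [folklore] linear algebra and Lebesgue measure, Mathlib + [pv16's]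
`Beta.GaussianIntegral.integral_comp_mulVec` BY NAME):
1. §1 `det_eq_one_of_twoBlockUnitriangular` — a two-block triangular matrix with identity diagonal blocks has
   determinant `1` (`Matrix.twoBlockTriangular_det`).
2. §2 `jac_det` — `det(jac blk w) = 1` for EVERY idempotent block map and every weight system summing to `1` on each
   block (proof: the column operation `U = colOp blk` adding the non-base columns of each block to its base column turns
   `jac` into `jacL` — `jac_mul_colOp` — and `U`, `jacL` are two-block unitriangular for the base/non-base partition);
   `jacStar_det` — the single-block case (the print's block `B(y)`: row `y` = the weights, rows `x ≠ y` = `e_x − e_y`).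
3. §3 `det_colour` — `det(1_𝔤 ⊗ jac) = 1` (`Matrix.det_kronecker`); `abs_det_orthogonal`, `abs_det_transport` —
   `|det T| = 1` for sitewise orthogonal transports (`Matrix.det_blockDiagonal`); `fullJac_apply` (the reading above);
   `abs_det_fullJac` — **`|det 𝒥| = 1`**.
4. §4 `integral_delta_linear` — for ANY nonsingular `𝒥`: `∫dμ G(μ)ψ(𝒥μ) = |det 𝒥|⁻¹ ∫dc G(𝒥⁻¹c)ψ(c)` (what a
   δ-function of linear constraints produces in general); `eq_3168` — for `|det 𝒥| = 1` the constant is absent: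
   `∫dμ G(μ)ψ(𝒥μ) = ∫dc G(𝒥⁻¹c)ψ(c)`, i.e. *"the integral (3.168) is equal to G(μ(B))"* with `μ(B) = 𝒥⁻¹c(B)`;
   `eq_3168_full` — the same for `𝒥 = (1_𝔤 ⊗ jac blk w)·T` under the dictionary's hypotheses.
NOT CERTIFIED HERE (located): the identification of the print's `μ(B)` of (3.169) with `𝒥⁻¹c(B)` is by uniqueness
(`B9Eq3169Mu.AxialFrame.mu_unique`, by reference — this leaf does not import it); the instance "blocks of `L^d` points,
`w = L^{−d}`, contours (52)–(53) of [`Balaban1985Averaging`]" (C-B9-57 residual (ii)); the `B`-integration and the rest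
of (3.167) → (3.170) (G-adv8-1, G-adv4-33, C-adv4-55 by hand; (3.160)–(3.167) at measure level in `B9Eq3166`).
Elementary; NOT summit progress; NOT continuum; NOT Clay. -/

namespace Literature.MathematicalPhysics.QuantumFieldTheory.Balaban1983to89.B9Eq3168Jac

open Matrix MeasureTheory
open scoped Kronecker

noncomputable section

/-! ## §1  Two-block unitriangular matrices have determinant one -/

section TwoBlock

variable {m : Type*} [Fintype m] [DecidableEq m]

/-- A matrix which is block triangular for a two-block partition `p / ¬p`, with IDENTITY diagonal blocks, has
determinant `1`. [folklore] -/
theorem det_eq_one_of_twoBlockUnitriangular (M : Matrix m m ℝ) (p : m → Prop) [DecidablePred p]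
    (h0 : ∀ i, ¬p i → ∀ j, p j → M i j = 0) (h1 : ∀ i j, p i → p j → M i j = if i = j then 1 else 0)
    (h2 : ∀ i j, ¬p i → ¬p j → M i j = if i = j then 1 else 0) : M.det = 1 := by
  rw [Matrix.twoBlockTriangular_det M p h0]
  have e1 : M.toSquareBlockProp p = 1 := by
    ext ⟨i, hi⟩ ⟨j, hj⟩
    rw [toSquareBlockProp_def, of_apply, h1 i j hi hj, Matrix.one_apply]
    simp only [Subtype.mk.injEq]
  have e2 : (M.toSquareBlockProp fun i => ¬p i) = 1 := by
    ext ⟨i, hi⟩ ⟨j, hj⟩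
    rw [toSquareBlockProp_def, of_apply, h2 i j hi hj, Matrix.one_apply]
    simp only [Subtype.mk.injEq]
  rw [e1, e2, det_one, det_one, mul_one]

end TwoBlock

/-! ## §2  The site-level constraint matrix `jac` and `det jac = 1` -/

section Jac

variable {S : Type*} [Fintype S] [DecidableEq S]

/-- The CONSTRAINT MATRIX on sites, in the transported variables `ν`: row `i` a base point (`blk i = i`):
`ν ↦ Σ_{blk j = i} w j · ν(j)` (the block average `(Q′μ)(i)`); row `i` non-base: `ν ↦ ν(i) − ν(blk i)` (the axial
constraint along `Γ_{blk i, i}`).  READING of the linear map inside the δ-functions of (3.168). [folklore] -/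
def jac (blk : S → S) (w : S → ℝ) : Matrix S S ℝ := fun i j =>
  if blk i = i then (if blk j = i then w j else 0) else (if i = j then 1 else 0) - (if blk i = j then 1 else 0)

/-- The column operation "add every non-base column to the base column of its block": `U = 1 + E`,
`E k j = [k non-base ∧ j = blk k]`. [folklore] -/
def colOp (blk : S → S) : Matrix S S ℝ := fun k j =>
  (if k = j then 1 else 0) + (if blk k ≠ k ∧ blk k = j then 1 else 0)

/-- The result of the column operation: identity plus the weights of the non-base points in the base rows. [folklore] -/
def jacL (blk : S → S) (w : S → ℝ) : Matrix S S ℝ := fun i j =>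
  (if i = j then 1 else 0) + (if blk i = i ∧ blk j ≠ j ∧ blk j = i then w j else 0)

/-- Row sums of `jac · E`, base rows. [folklore] -/
theorem sum_base (blk : S → S) (w : S → ℝ)
    (hw : ∀ y, blk y = y → ∑ x ∈ Finset.univ.filter (fun x => blk x = y), w x = 1) (i j : S) (hi : blk i = i) :
    ∑ k, (if blk k ≠ k ∧ blk k = j then (if blk k = i then w k else 0) else 0) =
      if i = j then 1 - w i else 0 := by
  by_cases hij : i = j
  · subst hij
    rw [if_pos rfl]
    have hmem : i ∈ Finset.univ.filter (fun x => blk x = i) := by simp [hi]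
    have hsub := Finset.sum_erase_eq_sub (f := w) hmem
    rw [hw i hi] at hsub
    rw [← hsub, ← Finset.sum_filter_add_sum_filter_not Finset.univ (fun k => blk k ≠ k ∧ blk k = i)]
    have hz : ∑ k ∈ Finset.univ.filter (fun k => ¬(blk k ≠ k ∧ blk k = i)),
        (if blk k ≠ k ∧ blk k = i then (if blk k = i then w k else 0) else 0) = 0 := by
      refine Finset.sum_eq_zero (fun k hk => ?_)
      rw [Finset.mem_filter] at hk
      rw [if_neg hk.2]
    rw [hz, add_zero]
    have hset : Finset.univ.filter (fun k => blk k ≠ k ∧ blk k = i) =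
        (Finset.univ.filter (fun x => blk x = i)).erase i := by
      ext k
      simp only [Finset.mem_filter, Finset.mem_univ, true_and, Finset.mem_erase]
      constructor
      · rintro ⟨h1, h2⟩; exact ⟨fun h => h1 (h2.trans h.symm), h2⟩
      · rintro ⟨h1, h2⟩; exact ⟨fun h => h1 (h.symm.trans h2), h2⟩
    rw [hset]
    refine Finset.sum_congr rfl (fun k hk => ?_)
    rw [Finset.mem_erase, Finset.mem_filter] at hk
    have h2 : blk k = i := hk.2.2
    have h1 : blk k ≠ k := fun h => hk.1 (h.symm.trans h2)
    rw [if_pos ⟨h1, h2⟩, if_pos h2]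
  · rw [if_neg hij]
    refine Finset.sum_eq_zero (fun k _ => ?_)
    by_cases hc : blk k ≠ k ∧ blk k = j
    · rw [if_pos hc, if_neg (fun h => hij (h.symm.trans hc.2))]
    · rw [if_neg hc]

/-- Row sums of `jac · E`, non-base rows. [folklore] -/
theorem sum_nonbase (blk : S → S) (hblk : ∀ x, blk (blk x) = blk x) (i j : S) (hi : blk i ≠ i) :
    ∑ k, (if blk k ≠ k ∧ blk k = j then ((if i = k then (1 : ℝ) else 0) - (if blk i = k then 1 else 0)) else 0) =
      if blk i = j then 1 else 0 := by
  rw [Finset.sum_eq_single i]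
  · by_cases hj : blk i = j
    · rw [if_pos ⟨hi, hj⟩, if_pos rfl, if_neg (fun h => hi h), if_pos hj, sub_zero]
    · rw [if_neg (fun h => hj h.2), if_neg hj]
  · intro k _ hk
    by_cases hc : blk k ≠ k ∧ blk k = j
    · rw [if_pos hc, if_neg (fun h => hk h.symm), if_neg (fun h => hc.1 (by rw [← h, hblk])), sub_zero]
    · rw [if_neg hc]
  · intro h; exact absurd (Finset.mem_univ i) h

/-- THE COLUMN OPERATION: `jac · U = jacL`. [folklore] -/
theorem jac_mul_colOp (blk : S → S) (hblk : ∀ x, blk (blk x) = blk x) (w : S → ℝ)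
    (hw : ∀ y, blk y = y → ∑ x ∈ Finset.univ.filter (fun x => blk x = y), w x = 1) :
    jac blk w * colOp blk = jacL blk w := by
  ext i j
  rw [Matrix.mul_apply]
  simp only [colOp, mul_add, Finset.sum_add_distrib, mul_ite, mul_one, mul_zero, Finset.sum_ite_eq',
    Finset.mem_univ, if_true]
  by_cases hi : blk i = i
  · have h := sum_base blk w hw i j hi
    simp only [jac, jacL, hi, if_true, true_and] at h ⊢
    rw [h]
    by_cases hij : i = j
    · subst hij
      rw [if_pos hi, if_pos rfl, if_pos rfl, if_neg (fun h => h.1 hi)]; ring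
    · rw [if_neg hij, if_neg hij, add_zero, zero_add]
      by_cases hj : blk j = i
      · rw [if_pos hj, if_pos (show blk j ≠ j ∧ blk j = i from ⟨fun h => hij (hj.symm.trans h), hj⟩)]
      · rw [if_neg hj, if_neg (show ¬(blk j ≠ j ∧ blk j = i) from fun h => hj h.2)]
  · have h := sum_nonbase blk hblk i j hi
    simp only [jac, jacL, hi, if_false, false_and] at h ⊢
    rw [h]
    ring

/-- `det U = 1`. [folklore] -/
theorem colOp_det (blk : S → S) (hblk : ∀ x, blk (blk x) = blk x) : (colOp blk).det = 1 := by
  refine det_eq_one_of_twoBlockUnitriangular (colOp blk) (fun x => blk x ≠ x) ?_ ?_ ?_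
  · intro i hi j hj
    have hi' : blk i = i := not_not.mp hi
    have hij : i ≠ j := fun h => hj (by rw [← h]; exact hi')
    simp only [colOp]
    rw [if_neg hij, if_neg (show ¬(blk i ≠ i ∧ blk i = j) from fun h => h.1 hi'), add_zero]
  · intro i j _ hj
    simp only [colOp]
    rw [if_neg (show ¬(blk i ≠ i ∧ blk i = j) from fun h => hj (by rw [← h.2, hblk])), add_zero]
  · intro i j hi _
    simp only [colOp]
    rw [if_neg (show ¬(blk i ≠ i ∧ blk i = j) from fun h => h.1 (not_not.mp hi)), add_zero]

/-- `det jacL = 1`. [folklore] -/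
theorem jacL_det (blk : S → S) (w : S → ℝ) : (jacL blk w).det = 1 := by
  refine det_eq_one_of_twoBlockUnitriangular (jacL blk w) (fun x => blk x = x) ?_ ?_ ?_
  · intro i hi j hj
    have hij : i ≠ j := fun h => hi (by rw [h]; exact hj)
    simp only [jacL]
    rw [if_neg hij, if_neg (show ¬(blk i = i ∧ blk j ≠ j ∧ blk j = i) from fun h => hi h.1), add_zero]
  · intro i j _ hj
    simp only [jacL]
    rw [if_neg (show ¬(blk i = i ∧ blk j ≠ j ∧ blk j = i) from fun h => h.2.1 hj), add_zero]
  · intro i j hi _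
    simp only [jacL]
    rw [if_neg (show ¬(blk i = i ∧ blk j ≠ j ∧ blk j = i) from fun h => hi h.1), add_zero]

/-- **`det jac = 1`** — for every idempotent block map `blk` and every weight system with `Σ_{B(y)} w = 1` on each
block: the Jacobian of `(averaging ⊕ axial constraints)` in the transported variables is exactly one.
[cite: Balaban1985BackgroundPropagators, (3.168)-(3.169) p.430] -/
theorem jac_det (blk : S → S) (hblk : ∀ x, blk (blk x) = blk x) (w : S → ℝ)
    (hw : ∀ y, blk y = y → ∑ x ∈ Finset.univ.filter (fun x => blk x = y), w x = 1) : (jac blk w).det = 1 := by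
  have h := congrArg Matrix.det (jac_mul_colOp blk hblk w hw)
  rwa [det_mul, colOp_det blk hblk, jacL_det, mul_one] at h

/-- The SINGLE BLOCK `B(y)` of the print: row `y` = the weights (`Σ w = 1`), rows `x ≠ y` = `e_x − e_y`; determinant `1`.
[cite: Balaban1985BackgroundPropagators, (3.168)-(3.169) p.430] -/
theorem jacStar_det (y : S) (w : S → ℝ) (hw : ∑ x, w x = 1) : (jac (fun _ => y) w).det = 1 := by
  refine jac_det (fun _ => y) (fun _ => rfl) w (fun y' hy' => ?_)
  subst hy'
  simpa using hw

omit [Fintype S] in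
/-- The single-block matrix, explicitly. [folklore] -/
theorem jacStar_apply (y : S) (w : S → ℝ) (i j : S) :
    jac (fun _ => y) w i j = if y = i then w j else (if i = j then 1 else 0) - (if y = j then 1 else 0) := by
  by_cases h : y = i
  · simp only [jac, h, if_true]
  · simp only [jac, h, if_false]

end Jac

/-! ## §3  Colour components and orthogonal transports: `|det 𝒥| = 1` -/

section Full

variable {S d : Type*} [Fintype S] [DecidableEq S] [Fintype d] [DecidableEq d]

/-- `det(1_𝔤 ⊗ J) = 1` when `det J = 1` (`Matrix.det_kronecker`). [folklore] -/
theorem det_colour (J : Matrix S S ℝ) (hJ : J.det = 1) : ((1 : Matrix d d ℝ) ⊗ₖ J).det = 1 := by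
  rw [Matrix.det_kronecker, det_one, one_pow, hJ, one_pow, mul_one]

omit [Fintype S] [DecidableEq S] in
/-- An orthogonal matrix has `|det| = 1`. [folklore] -/
theorem abs_det_orthogonal (O : Matrix d d ℝ) (h : Oᵀ * O = 1) : |O.det| = 1 := by
  have h2 : O.det * O.det = 1 := by
    have h' := congrArg Matrix.det h
    rwa [det_mul, det_transpose, det_one] at h'
  rcases mul_self_eq_one_iff.mp h2 with h1 | h1
  · rw [h1, abs_one]
  · rw [h1, abs_neg, abs_one]

/-- The sitewise transport `T = blockDiagonal O`, `O x = R(V(Γ_{blk x,x}))` orthogonal: `|det T| = 1`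
(`Matrix.det_blockDiagonal`). [folklore] -/
theorem abs_det_transport (O : S → Matrix d d ℝ) (hO : ∀ x, (O x)ᵀ * O x = 1) :
    |(blockDiagonal O).det| = 1 := by
  rw [det_blockDiagonal, Finset.abs_prod]
  exact Finset.prod_eq_one (fun x _ => abs_det_orthogonal (O x) (hO x))

/-- THE READING: `((1_𝔤 ⊗ J)·T)μ` at colour `a`, site `x` is `Σ_{x′} J x x′ · ((O x′)μ(x′))_a` — row `x` of `J` applied to
the transported variables `ν(x′) = (O x′)μ(x′)`. [folklore] -/
theorem fullJac_apply (J : Matrix S S ℝ) (O : S → Matrix d d ℝ) (a b : d) (x x' : S) :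
    ((1 : Matrix d d ℝ) ⊗ₖ J * blockDiagonal O) (a, x) (b, x') = J x x' * O x' a b := by
  rw [Matrix.mul_apply, Fintype.sum_prod_type]
  simp only [Matrix.kronecker_apply, Matrix.one_apply, blockDiagonal_apply', ite_mul, one_mul, zero_mul,
    Finset.sum_ite_eq, Finset.mem_univ, if_true, mul_ite, mul_zero, Finset.sum_ite_eq']

/-- **`|det 𝒥| = 1`** for `𝒥 = (1_𝔤 ⊗ jac)·T`: the full Jacobian of the constraints of (3.168) in the original variables
`μ`. [cite: Balaban1985BackgroundPropagators, (3.168)-(3.169) p.430] -/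
theorem abs_det_fullJac (J : Matrix S S ℝ) (hJ : J.det = 1) (O : S → Matrix d d ℝ)
    (hO : ∀ x, (O x)ᵀ * O x = 1) : |((1 : Matrix d d ℝ) ⊗ₖ J * blockDiagonal O).det| = 1 := by
  rw [det_mul, abs_mul, det_colour J hJ, abs_one, one_mul, abs_det_transport O hO]

end Full

/-! ## §4  Measure level: what a δ-function of linear constraints produces -/

section Delta

variable {ι : Type*} [Fintype ι] [DecidableEq ι]

/-- For ANY nonsingular `𝒥`: `∫dμ G(μ)ψ(𝒥μ) = |det 𝒥|⁻¹ · ∫dc G(𝒥⁻¹c)ψ(c)` — the tested form of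
"`∫dμ δ(𝒥μ − c)G(μ) = |det 𝒥|⁻¹G(𝒥⁻¹c)`" ([pv16's] `integral_comp_mulVec`, by name). [folklore] -/
theorem integral_delta_linear (Jm : Matrix ι ι ℝ) (hJ : Jm.det ≠ 0) (G ψ : (ι → ℝ) → ℝ) :
    ∫ μ : ι → ℝ, G μ * ψ (Jm *ᵥ μ) = |Jm.det|⁻¹ * ∫ c : ι → ℝ, G (Jm⁻¹ *ᵥ c) * ψ c := by
  have h := Beta.GaussianIntegral.integral_comp_mulVec Jm hJ (fun c => G (Jm⁻¹ *ᵥ c) * ψ c)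
  simp only [mulVec_mulVec, Matrix.nonsing_inv_mul _ (isUnit_iff_ne_zero.mpr hJ), one_mulVec] at h
  exact h

/-- **(3.168) = G(μ(B))**: when `|det 𝒥| = 1` NO constant appears — `∫dμ G(μ)ψ(𝒥μ) = ∫dc G(𝒥⁻¹c)ψ(c)`, i.e.
`∫dμ δ(𝒥μ − c)G(μ) = G(𝒥⁻¹c)` at every data point `c`, `μ(B) := 𝒥⁻¹c(B)`. [cite: Balaban1985BackgroundPropagators,
(3.168) p.430] -/
theorem eq_3168 (Jm : Matrix ι ι ℝ) (hJ : |Jm.det| = 1) (G ψ : (ι → ℝ) → ℝ) :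
    ∫ μ : ι → ℝ, G μ * ψ (Jm *ᵥ μ) = ∫ c : ι → ℝ, G (Jm⁻¹ *ᵥ c) * ψ c := by
  have h0 : Jm.det ≠ 0 := by
    intro h; rw [h, abs_zero] at hJ; exact zero_ne_one hJ
  rw [integral_delta_linear Jm h0, hJ, inv_one, one_mul]

/-- (3.168) for the dictionary's `𝒥 = (1_𝔤 ⊗ jac blk w)·blockDiagonal O`: idempotent blocks, weights summing to one
per block, orthogonal transports ⇒ `∫dμ G(μ)ψ(𝒥μ) = ∫dc G(𝒥⁻¹c)ψ(c)`. [cite: Balaban1985BackgroundPropagators,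
(3.168)-(3.169) p.430] -/
theorem eq_3168_full {S d : Type*} [Fintype S] [DecidableEq S] [Fintype d] [DecidableEq d]
    (blk : S → S) (hblk : ∀ x, blk (blk x) = blk x) (w : S → ℝ)
    (hw : ∀ y, blk y = y → ∑ x ∈ Finset.univ.filter (fun x => blk x = y), w x = 1)
    (O : S → Matrix d d ℝ) (hO : ∀ x, (O x)ᵀ * O x = 1) (G ψ : (d × S → ℝ) → ℝ) :
    ∫ μ : d × S → ℝ, G μ * ψ (((1 : Matrix d d ℝ) ⊗ₖ jac blk w * blockDiagonal O) *ᵥ μ) =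
      ∫ c : d × S → ℝ, G (((1 : Matrix d d ℝ) ⊗ₖ jac blk w * blockDiagonal O)⁻¹ *ᵥ c) * ψ c :=
  eq_3168 _ (abs_det_fullJac (jac blk w) (jac_det blk hblk w hw) O hO) G ψ

end Delta

end

end Literature.MathematicalPhysics.QuantumFieldTheory.Balaban1983to89.B9Eq3168Jac
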